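/-
Copyright (c) 2026 the pub-hodgecm-mathlib formalisation cell (harness21).  Prover seat hodgecm-mathlib-K2E1-p13 (g6), Track B ∕ K2-LIT, h413 = `stmt-HodgeConjecture-24833`,
R90-TF section S8 «ContSpec-n½», S8 dealer R90-CS-plan (g3) S8-R221 (5) ∕ S8-R222 (b) ruling J-S8-UNF, file (5b) announced 02:26Z∕02:39Z: THE ARCHIMEDEAN COLUMN OF `hsrc`, PHASE FOR
PHASE — ★ p864477's shifted big-cell law rewritten in (V) OF RECORD's `ζ`-letters, and the torus element `⟨det ι_∞((ι(w₀)·u)_∞)⟩ = (−1_∞, 1_f)`, whose `ξ.ψ`-value is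
`∏_w unfoldingArchPhase ξ w` (★ p864662, file (5a)).
-/
import Summits.HodgeConjecture.HodgeConjecture.Theorems.K2E1ChiUnfoldingConstantsOfRecordU3   -- ★ p864662 (this seat, file (5a)): `unfoldingArchPhase`, `ψ_eq_prod_unfoldingArchPhase_of_coe_eq`, `neg_one_zpow_mul_conj_archUnitaryValue`
import Summits.HodgeConjecture.HodgeConjecture.Theorems.K2E1ChiArchBigCellLastRowReadingsU3  -- ★ p864477 (R90-CS-p03): `archSectionShifted_midBlock_bigCell_of_record`; brings ★ `embedding_re_eq_zero`
import Summits.HodgeConjecture.HodgeConjecture.Theorems.K2E1ChiDetCharTorusDescentU2        -- ★ (K2E1-p13 (g3)): `adelicDet_eq_one_of_mem_adelicUnipotent` (`det u = 1` on `N(𝔸)`)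
import Literature.NumberTheory.Automorphic.UnitaryGroupAdelicProduct                         -- ★ `archPart`, `finPart`, `archToAdelic_mul_finAdelicToAdelic` (`g = (g_∞,1)·(1,g_f)`)
import Literature.NumberTheory.Automorphic.UnitaryGroupRestrictedProduct                      -- ★ `adelicVal_finAdelicToAdelic`, `map_fst_ofFinite` (`(1, g_f)_∞ = 1`)
import Literature.NumberTheory.Automorphic.UnitaryGroupRankOneBigCell                         -- ★ `coe_coe_weylLongU_three` (`w₀ = antidiag(1,1,1)`, `det w₀ = −1`)
import HarnessLib

/-!
# K2·E1 ∕ R90·S8 — `K2E1ChiUnfoldingArchPhaseOfRecordU3`: THE ARCH PHASE OF RECORD — `⟨det ι_∞((ι(w₀)·u)_∞)⟩ = (−1_∞, 1_f)`, so ★ p13's shifted section at the big-cell element IS (V)'s integrand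
# `∏_w ε_w · archUnitaryValue m_w 0 ζ_w · ((2+ζ_w)∕ζ_w)^{p_w} · ((2+conj ζ_w)∕conj ζ_w)^{q_w}`, `ε := unfoldingArchPhase ξ`

Cell `pub/hodgecm-mathlib`, crux h413 = `stmt-HodgeConjecture-24833`, route of record `HCCMUnconditional`; R90-TF section S8 «ContSpec-n½», road R2-χ₃ ((V) OF RECORD row (iii) `hsrc`, ARCH
column; sequel of ★ p864662 (5a) `K2E1ChiUnfoldingConstantsOfRecordU3`).  THEOREMS ONLY (no `def`, no `instance`, no notation, no named-fact hypothesis, no `sorry`; default heartbeats); lane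
`--supports stmt-HodgeConjecture-24833 --as helper` (count-neutral).  CLOSES NO SOCKET: it discharges the ONE remaining archimedean unknown of the `hsrc` row — the torus value
`ξ.ψ⟨det ι_∞ a⟩` at the big-cell element of record — so that R90-CS-p03's unfolding head binds the arch factor of ★ (a-2b)'s `hfac` to (V)'s integrand BY NAME, with nothing archimedean
carried in the constant `C`.

THE MATHEMATICS ([BorelJacquet1979] §4.1; [Rogawski1990] §1.10 p. 9, §12.2 p. 174, §13.9 p. 229; [MoeglinWaldspurger1995] IV.1.11).  For `g = ι(w₀)·u ∈ U(2,1)(𝔸_{L⁺})` (`u ∈ N(𝔸)`):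
`det g = det w₀ · det u = (−1)·1 = −1` (the principal idele); `g = (g_∞, 1)·(1, g_f)` ([BorelJacquet1979] §4.1), and `det (1, g_f)` has archimedean part `1`, `det (g_∞, 1)` has finite part
`1`; hence `det (g_∞, 1) = ((det g)_∞, 1) = (−1_∞, 1_f)` — the archimedean idele `infiniteIdeles (−1)` of ★ (5a), on which `ξ.ψ` takes the value `∏_w (−1)^{eψ_w} = ∏_w unfoldingArchPhase ξ w`
(★ `ψ_eq_prod_unfoldingArchPhase_of_coe_eq`).  With ★ (5a)'s cancellation `(−1)^m·conj (archUnitaryValue m 0 (1 − conj Z)) = archUnitaryValue m 0 (Z − 1)` and the `ζ`-letter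
`Z_w − 1 = ζ_w := −(1 + ‖X_w‖²∕2) + (Im φ_w(δ)·s_w)·I` (`Re φ_w(δ) = 0`, ★ `embedding_re_eq_zero`), ★ p864477's law becomes (V) OF RECORD's integrand, phase for phase.
* §1 `zeta_letter`, `add_one_eq_two_add`, `conj_add_one_eq_two_add` (the `ζ`-letter algebra).
* §2 THE TORUS ELEMENT: `coe_det_adelicVal_archToAdelic_archPart` (`det (g_∞, 1) = ((det g)_∞, 1)`, any `g`), `det_adelicVal_weylLongU_mul_unipotent` (`det (ι(w₀)·u) = −1`),
  **`det_archToAdelic_archPart_bigCell_eq_infiniteIdeles_neg_one`**, **`coe_adelicOneEquivTorus_adelicDet_bigCell`** (`⟨det ι_∞ a⟩ = (−1_∞, 1_f)` as an idele), and THE VALUE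
  **`adelicOneChar_adelicDet_bigCell_eq_prod_unfoldingArchPhase`**: `ξ.ψ⟨det ι_∞((ι(w₀)·u)_∞)⟩ = ∏_w unfoldingArchPhase ξ w` for EVERY `u ∈ N(𝔸)`.
* §3 **`archSectionShifted_midBlock_bigCell_zeta`** (★ p864477 in the `ζ`-letter, times the torus value) and the HEAD **`archSectionShifted_midBlock_bigCell_eq_prod`** (UNCONDITIONAL):
  `Φ^{p,q}((ι(w₀)·u(X, θ t))_∞) = ∏_w unfoldingArchPhase ξ w · archUnitaryValue (kμ,w − 2eη,w) 0 ζ_w · ((2+ζ_w)∕ζ_w)^{p_w} · ((2+conj ζ_w)∕conj ζ_w)^{q_w}`.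
HONEST LABEL: HC_CM is proved only modulo the 7 printed citations (2 remaining named inputs: hLiu418 = `stmt-HodgeConjecture-24832`, h413 = `stmt-HodgeConjecture-24833`) until rung 0
closes; REL ≠ ★ ≠ BUILT; this file asserts no named fact and closes no socket (the `hsrc` row is R90-CS-p03's head; its finite column is the L core); count-neutral.

## References
* [BorelJacquet1979] A. Borel, H. Jacquet, *Automorphic forms and automorphic representations*, Corvallis PSPM 33.1 (1979): §4.1.
* [Rogawski1990] J. D. Rogawski, *Automorphic Representations of Unitary Groups in Three Variables*, Ann. of Math. Stud. 123 (1990): §1.10 p. 9, §12.2 p. 174, §13.9 p. 229.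
* [MoeglinWaldspurger1995] C. Mœglin, J.-L. Waldspurger, *Spectral Decomposition and Eisenstein Series* (1995): IV.1.11.
* [Patrikis2019] S. Patrikis, *Variations on a theorem of Tate*, Mem. AMS 258 (2019): §2.1.
-/

set_option autoImplicit false
set_option linter.dupNamespace false -- the mandated namespace repeats `HodgeConjecture.HodgeConjecture`

noncomputable section

open NumberField NumberField.InfinitePlace IsDedekindDomain
open scoped ComplexConjugate
open Literature.NumberTheory.Automorphic Literature.NumberTheory.Automorphic.UnitaryGroup Literature.NumberTheory.GaloisRepresentations AdelicGroupData
open Literature.NumberTheory.Automorphic.Arthur2013.Leaves.TECR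
open Literature.NumberTheory.Automorphic.UnitaryGroup.AdelicCharactersDetQuasiSplit (antidiagonal_over_det_ne_zero)
open Literature.NumberTheory.Rogawski1990 (OneDimAutRepH)
open Summit.HodgeConjecture.HodgeConjecture.Cruxes.H413
open Summit.HodgeConjecture.HodgeConjecture.Cruxes.H413.K2E1HeightBigCellLineFormulaU3 (embedding_re_eq_zero)
open Summit.HodgeConjecture.HodgeConjecture.Cruxes.H413.K2E1ChiArchBigCellLastRowReadingsU3 (archSectionShifted_midBlock_bigCell_of_record)
open Summit.HodgeConjecture.HodgeConjecture.Cruxes.H413.K2E1ChiDetCharTorusDescentU2 (adelicDet_eq_one_of_mem_adelicUnipotent)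
open Summit.HodgeConjecture.HodgeConjecture.Cruxes.H413.K2E1ChiUnfoldingConstantsOfRecordU3
open Summit.HodgeConjecture.HodgeConjecture.R90.S8

namespace Summit.HodgeConjecture.HodgeConjecture.Cruxes.H413.K2E1ChiUnfoldingArchPhaseOfRecordU3

variable (L : Type) [Field L] [NumberField L] [IsCMField L]

/-! ## §1 The `ζ`-letter algebra -/

section Zeta

/-- **The `ζ`-letter**: for `Re φ = 0` (`φ = φ_w(δ)`, ★ `embedding_re_eq_zero`), `s·φ − r²∕2 − 1 = −(1 + r²∕2) + (Im φ·s)·I`. [folklore] -/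
theorem zeta_letter {φ : ℂ} (hφ : φ.re = 0) (s r : ℝ) :
    ((s : ℂ) * φ - ((r ^ 2 / 2 : ℝ) : ℂ)) - 1 = (((-(1 + r ^ 2 / 2)) : ℝ) : ℂ) + (((φ.im * s : ℝ)) : ℂ) * Complex.I := by
  apply Complex.ext
  · simp only [Complex.sub_re, Complex.mul_re, Complex.ofReal_re, Complex.ofReal_im, Complex.add_re, Complex.I_re, Complex.I_im, Complex.one_re, hφ]
    ring
  · simp only [Complex.sub_im, Complex.mul_im, Complex.ofReal_re, Complex.ofReal_im, Complex.add_im, Complex.I_re, Complex.I_im, Complex.one_im, hφ]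
    ring

/-- `Z + 1 = 2 + ζ` for `ζ = Z − 1`. [folklore] -/
theorem add_one_eq_two_add {Z ζ : ℂ} (h : Z - 1 = ζ) : Z + 1 = 2 + ζ := by
  rw [← h]; ring

/-- `conj Z + 1 = 2 + conj ζ`, `conj Z − 1 = conj ζ` for `ζ = Z − 1`. [folklore] -/
theorem conj_add_one_eq_two_add {Z ζ : ℂ} (h : Z - 1 = ζ) : conj Z + 1 = 2 + conj ζ ∧ conj Z - 1 = conj ζ := by
  constructor
  · rw [← h, map_sub, map_one]; ring
  · rw [← h, map_sub, map_one]

end Zeta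

/-! ## §2 The torus element: `det ((ι(w₀)·u)_∞, 1) = (−1_∞, 1_f)` and its `ξ.ψ`-value -/

section Torus

/-- **`det (g_∞, 1) = ((det g)_∞, 1)`** for every `g ∈ U(2,1)(𝔸_{L⁺})`: `g = (g_∞, 1)·(1, g_f)` (★ `archToAdelic_mul_finAdelicToAdelic`), the archimedean part of `det (1, g_f)` is `1` (★ `map_fst_ofFinite`) and the
finite part of `det (g_∞, 1)` is `1` (★ `map_snd_ofInfinite`). [cite: BorelJacquet1979, §4.1] -/
theorem coe_det_adelicVal_archToAdelic_archPart (g : (quasiSplit (↥(maximalRealSubfield L)) L (IsCMField.complexConj L) 3).Adelic) :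
    ((Matrix.GeneralLinearGroup.det (adelicVal (↥(maximalRealSubfield L)) L (IsCMField.complexConj L) 3 ((StdForm.antidiagonal 3).over L)
        (archToAdelic (↥(maximalRealSubfield L)) L (IsCMField.complexConj L) 3 ((StdForm.antidiagonal 3).over L)
          (archPart (↥(maximalRealSubfield L)) L (IsCMField.complexConj L) 3 ((StdForm.antidiagonal 3).over L) g))) : (AdeleRing (𝓞 L) L)ˣ) : AdeleRing (𝓞 L) L) =
      ((((Matrix.GeneralLinearGroup.det (adelicVal (↥(maximalRealSubfield L)) L (IsCMField.complexConj L) 3 ((StdForm.antidiagonal 3).over L) g)) : (AdeleRing (𝓞 L) L)ˣ) : AdeleRing (𝓞 L) L).1,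
        (1 : FiniteAdeleRing (𝓞 L) L)) := by
  have hfst : ∀ X : GL (Fin 3) (AdeleRing (𝓞 L) L), (((Matrix.GeneralLinearGroup.det X : (AdeleRing (𝓞 L) L)ˣ) : AdeleRing (𝓞 L) L)).1 = (X.val.map (adeleFst L)).det := fun X => by
    rw [Matrix.GeneralLinearGroup.val_det_apply]
    exact RingHom.map_det (adeleFst L) X.val
  have hsnd : ∀ X : GL (Fin 3) (AdeleRing (𝓞 L) L), (((Matrix.GeneralLinearGroup.det X : (AdeleRing (𝓞 L) L)ˣ) : AdeleRing (𝓞 L) L)).2 = (X.val.map (adeleSnd L)).det := fun X => by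
    rw [Matrix.GeneralLinearGroup.val_det_apply]
    exact RingHom.map_det (adeleSnd L) X.val
  have hmul1 : ∀ x y : AdeleRing (𝓞 L) L, (x * y).1 = x.1 * y.1 := fun _ _ => rfl
  refine Prod.ext ?_ ?_
  · conv_rhs => rw [← archToAdelic_mul_finAdelicToAdelic (↥(maximalRealSubfield L)) L (IsCMField.complexConj L) 3 ((StdForm.antidiagonal 3).over L) g]
    rw [map_mul, map_mul, Units.val_mul, hmul1,
      hfst (adelicVal (↥(maximalRealSubfield L)) L (IsCMField.complexConj L) 3 ((StdForm.antidiagonal 3).over L)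
        (finAdelicToAdelic (↥(maximalRealSubfield L)) L (IsCMField.complexConj L) 3 ((StdForm.antidiagonal 3).over L)
          (finPart (↥(maximalRealSubfield L)) L (IsCMField.complexConj L) 3 ((StdForm.antidiagonal 3).over L) g))),
      adelicVal_finAdelicToAdelic, map_fst_ofFinite, Matrix.det_one, mul_one]
  · rw [hsnd, adelicVal_archToAdelic, map_snd_ofInfinite, Matrix.det_one]

/-- **`det (ι(w₀)·u) = −1`** in `𝔸_Lˣ` for every `u ∈ N(𝔸)` (`w₀ = antidiag(1,1,1)` has determinant `−1`, ★ `coe_coe_weylLongU_three`; `det u = 1`, ★ `adelicDet_eq_one_of_mem_adelicUnipotent`).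
[cite: Rogawski1990, §1.10 p. 9] -/
theorem det_adelicVal_weylLongU_mul_unipotent (u : ↥(adelicUnipotent (↥(maximalRealSubfield L)) L (IsCMField.complexConj L) 3)) :
    Matrix.GeneralLinearGroup.det (adelicVal (↥(maximalRealSubfield L)) L (IsCMField.complexConj L) 3 ((StdForm.antidiagonal 3).over L)
        ((quasiSplit (↥(maximalRealSubfield L)) L (IsCMField.complexConj L) 3).toAdelic (weylLongU ((IsCMField.complexConj L : L ≃ₐ[↥(maximalRealSubfield L)] L) : L →+* L) (rfl : (StdForm.antidiagonal 3).over L = (StdForm.antidiagonal 3).over L)) *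
          (u : (quasiSplit (↥(maximalRealSubfield L)) L (IsCMField.complexConj L) 3).Adelic))) = -1 := by
  rw [map_mul, map_mul]
  have h1 : Matrix.GeneralLinearGroup.det (adelicVal (↥(maximalRealSubfield L)) L (IsCMField.complexConj L) 3 ((StdForm.antidiagonal 3).over L)
      ((quasiSplit (↥(maximalRealSubfield L)) L (IsCMField.complexConj L) 3).toAdelic (weylLongU ((IsCMField.complexConj L : L ≃ₐ[↥(maximalRealSubfield L)] L) : L →+* L) (rfl : (StdForm.antidiagonal 3).over L = (StdForm.antidiagonal 3).over L)))) = -1 := by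
    apply Units.ext
    rw [Matrix.GeneralLinearGroup.val_det_apply, Units.val_neg, Units.val_one]
    change ((((weylLongU ((IsCMField.complexConj L : L ≃ₐ[↥(maximalRealSubfield L)] L) : L →+* L) (rfl : (StdForm.antidiagonal 3).over L = (StdForm.antidiagonal 3).over L) :
        ↥(unitaryGroupOfForm ((IsCMField.complexConj L : L ≃ₐ[↥(maximalRealSubfield L)] L) : L →+* L) ((StdForm.antidiagonal 3).over L))) : GL (Fin 3) L) : Matrix (Fin 3) (Fin 3) L).map
        (algebraMap L (AdeleRing (𝓞 L) L))).det = -1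
    rw [← RingHom.mapMatrix_apply, ← RingHom.map_det, coe_coe_weylLongU_three, Matrix.det_fin_three]
    simp
  have h2 : Matrix.GeneralLinearGroup.det (adelicVal (↥(maximalRealSubfield L)) L (IsCMField.complexConj L) 3 ((StdForm.antidiagonal 3).over L)
      (u : (quasiSplit (↥(maximalRealSubfield L)) L (IsCMField.complexConj L) 3).Adelic)) = 1 := by
    have h := congrArg (fun x : ↥(adelicOne (↥(maximalRealSubfield L)) L (IsCMField.complexConj L)) => (x : (AdeleRing (𝓞 L) L)ˣ))
      (adelicDet_eq_one_of_mem_adelicUnipotent (antidiagonal_over_det_ne_zero L 3) u.2)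
    rw [adelicVal_apply]
    simpa only [coe_adelicDet, OneMemClass.coe_one] using h
  rw [h1, h2, mul_one]

/-- **`det ((ι(w₀)·u)_∞, 1) = (−1_∞, 1_f)` = `infiniteIdeles (−1)`** in `𝔸_Lˣ`, for every `u ∈ N(𝔸)`. [cite: BorelJacquet1979, §4.1] [cite: Rogawski1990, §1.10 p. 9] -/
theorem det_archToAdelic_archPart_bigCell_eq_infiniteIdeles_neg_one (u : ↥(adelicUnipotent (↥(maximalRealSubfield L)) L (IsCMField.complexConj L) 3)) :
    Matrix.GeneralLinearGroup.det (adelicVal (↥(maximalRealSubfield L)) L (IsCMField.complexConj L) 3 ((StdForm.antidiagonal 3).over L)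
        (archToAdelic (↥(maximalRealSubfield L)) L (IsCMField.complexConj L) 3 ((StdForm.antidiagonal 3).over L)
          (archPart (↥(maximalRealSubfield L)) L (IsCMField.complexConj L) 3 ((StdForm.antidiagonal 3).over L)
            ((quasiSplit (↥(maximalRealSubfield L)) L (IsCMField.complexConj L) 3).toAdelic (weylLongU ((IsCMField.complexConj L : L ≃ₐ[↥(maximalRealSubfield L)] L) : L →+* L) (rfl : (StdForm.antidiagonal 3).over L = (StdForm.antidiagonal 3).over L)) *
              (u : (quasiSplit (↥(maximalRealSubfield L)) L (IsCMField.complexConj L) 3).Adelic))))) =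
      (infiniteIdeles L (-1) : ideleGroup L) := by
  apply Units.ext
  rw [coe_det_adelicVal_archToAdelic_archPart, det_adelicVal_weylLongU_mul_unipotent, Literature.NumberTheory.Automorphic.coe_infiniteIdeles_eq,
    Units.val_neg, Units.val_one, Units.val_neg, Units.val_one]
  rfl

/-- **THE TORUS ELEMENT OF RECORD**: the element `⟨det ι_∞((ι(w₀)·u)_∞)⟩ ∈ T(𝔸_{L⁺})` at which ★ `archSectionE`∕`archSectionShifted` evaluate `ξ.ψ` has underlying idele `(−1_∞, 1_f)`.
[cite: Rogawski1990, §13.9 p. 229] [cite: BorelJacquet1979, §4.1] -/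
theorem coe_adelicOneEquivTorus_adelicDet_bigCell (u : ↥(adelicUnipotent (↥(maximalRealSubfield L)) L (IsCMField.complexConj L) 3)) :
    ((adelicOneEquivTorus (↥(maximalRealSubfield L)) L (IsCMField.complexConj L)
        (adelicDet (↥(maximalRealSubfield L)) L (IsCMField.complexConj L) 3 ((StdForm.antidiagonal 3).over L) (antidiagonal_over_det_ne_zero L 3)
          (archToAdelic (↥(maximalRealSubfield L)) L (IsCMField.complexConj L) 3 ((StdForm.antidiagonal 3).over L)
            (archPart (↥(maximalRealSubfield L)) L (IsCMField.complexConj L) 3 ((StdForm.antidiagonal 3).over L)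
              ((quasiSplit (↥(maximalRealSubfield L)) L (IsCMField.complexConj L) 3).toAdelic (weylLongU ((IsCMField.complexConj L : L ≃ₐ[↥(maximalRealSubfield L)] L) : L →+* L) (rfl : (StdForm.antidiagonal 3).over L = (StdForm.antidiagonal 3).over L)) *
                (u : (quasiSplit (↥(maximalRealSubfield L)) L (IsCMField.complexConj L) 3).Adelic))))) : ↥(TorusDict.torus (IsCMField.complexConj L))) : ideleGroup L) =
      infiniteIdeles L (-1) := by
  rw [coe_adelicOneEquivTorus, coe_adelicDet]
  exact det_archToAdelic_archPart_bigCell_eq_infiniteIdeles_neg_one L u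

/-- **THE ARCH PHASE OF RECORD, EVALUATED**: `ξ.ψ⟨det ι_∞((ι(w₀)·u)_∞)⟩ = ∏_w unfoldingArchPhase ξ w = ∏_w (−1)^{eψ_w}` for every `ξ` and every `u ∈ N(𝔸)` (★ (5a)
`ψ_eq_prod_unfoldingArchPhase_of_coe_eq` at the torus element of record). [cite: Rogawski1990, §12.2 p. 174, §13.9 p. 229] [cite: Patrikis2019, §2.1] -/
theorem adelicOneChar_adelicDet_bigCell_eq_prod_unfoldingArchPhase (ξ : OneDimAutRepH L) (u : ↥(adelicUnipotent (↥(maximalRealSubfield L)) L (IsCMField.complexConj L) 3)) :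
    ((adelicOneChar (↥(maximalRealSubfield L)) L (IsCMField.complexConj L) ξ.ψ
        (adelicDet (↥(maximalRealSubfield L)) L (IsCMField.complexConj L) 3 ((StdForm.antidiagonal 3).over L) (antidiagonal_over_det_ne_zero L 3)
          (archToAdelic (↥(maximalRealSubfield L)) L (IsCMField.complexConj L) 3 ((StdForm.antidiagonal 3).over L)
            (archPart (↥(maximalRealSubfield L)) L (IsCMField.complexConj L) 3 ((StdForm.antidiagonal 3).over L)
              ((quasiSplit (↥(maximalRealSubfield L)) L (IsCMField.complexConj L) 3).toAdelic (weylLongU ((IsCMField.complexConj L : L ≃ₐ[↥(maximalRealSubfield L)] L) : L →+* L) (rfl : (StdForm.antidiagonal 3).over L = (StdForm.antidiagonal 3).over L)) *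
                (u : (quasiSplit (↥(maximalRealSubfield L)) L (IsCMField.complexConj L) 3).Adelic))))) : ℂˣ) : ℂ) =
      ∏ w : InfinitePlace L, unfoldingArchPhase L ξ w := by
  rw [adelicOneChar_apply]
  exact ψ_eq_prod_unfoldingArchPhase_of_coe_eq L ξ _ (coe_adelicOneEquivTorus_adelicDet_bigCell L u)

end Torus

/-! ## §3 ★ p864477's shifted big-cell law in (V)'s letters `ζ_w = −(1 + ‖X_w‖²∕2) + (Im φ_w(δ)·s_w)·I`, and the HEAD -/

section BigCell

variable {δ : L} (hcδ : IsCMField.complexConj L δ = -δ) (hδ : δ ≠ 0) (hc : IsCMField.complexConj L * IsCMField.complexConj L = 1)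

include hc in
/-- **★ p864477's LAW WITH THE SIGN CANCELLED AND IN THE `ζ`-LETTER OF (V)**: at the archimedean big-cell element of record `a = (ι(w₀)·u(X, θ t))_∞`, for `μω` of unitary type `(kμ, 0)`,
`Φ^{p,q}(a) = (∏_w archUnitaryValue m_w 0 ζ_w · ((2 + ζ_w)∕ζ_w)^{p_w} · ((2 + conj ζ_w)∕conj ζ_w)^{q_w}) · ξ.ψ⟨det ι_∞ a⟩`, `m_w = kμ,w − 2eη,w`,
`ζ_w = −(1 + ‖X_w‖²∕2) + (Im φ_w(δ)·s_w(t))·I` — (V) OF RECORD's integrand without `ε`, times the ONE torus value. [cite: MoeglinWaldspurger1995, IV.1.11] [cite: Rogawski1990, §13.9 p. 229] -/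
theorem archSectionShifted_midBlock_bigCell_zeta (ξ : OneDimAutRepH L) {μω : HeckeCharacter L} {kμ : InfinitePlace L → ℤ} (hμ : μω.HasUnitaryArchType kμ 0)
    (p q : InfinitePlace L → ℕ) (X : AdeleRing (𝓞 L) L) (t : AdeleRing (𝓞 ↥(maximalRealSubfield L)) ↥(maximalRealSubfield L)) :
    archSectionShifted L (ξ.bcη⁻¹ * ξ.bcψ⁻¹ * μω) ξ.ψ p q (archPart (↥(maximalRealSubfield L)) L (IsCMField.complexConj L) 3 ((StdForm.antidiagonal 3).over L)
        ((quasiSplit (↥(maximalRealSubfield L)) L (IsCMField.complexConj L) 3).toAdelic (weylLongU ((IsCMField.complexConj L : L ≃ₐ[↥(maximalRealSubfield L)] L) : L →+* L) (rfl : (StdForm.antidiagonal 3).over L = (StdForm.antidiagonal 3).over L)) *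
          ((heisChart hc (X, traceZeroLine (↥(maximalRealSubfield L)) L (IsCMField.complexConj L) hcδ hδ t) : adelicUnipotent (↥(maximalRealSubfield L)) L (IsCMField.complexConj L) 3) :
            (quasiSplit (↥(maximalRealSubfield L)) L (IsCMField.complexConj L) 3).Adelic))) =
      (∏ w : InfinitePlace L, archUnitaryValue (kμ w - 2 * ξ.eη w) 0 ((((-(1 + ‖X.1 w‖ ^ 2 / 2)) : ℝ) : ℂ) + (((w.embedding δ).im * ((InfiniteAdeleRing.ringEquiv_mixedSpace ↥(maximalRealSubfield L)) t.1).1 ⟨w.comap (algebraMap ↥(maximalRealSubfield L) L), K2E1HeightBigCellLineFormulaU2.isReal_comap_maximalRealSubfield L w⟩ : ℝ) : ℂ) * Complex.I) *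
        (((2 : ℂ) + ((((-(1 + ‖X.1 w‖ ^ 2 / 2)) : ℝ) : ℂ) + (((w.embedding δ).im * ((InfiniteAdeleRing.ringEquiv_mixedSpace ↥(maximalRealSubfield L)) t.1).1 ⟨w.comap (algebraMap ↥(maximalRealSubfield L) L), K2E1HeightBigCellLineFormulaU2.isReal_comap_maximalRealSubfield L w⟩ : ℝ) : ℂ) * Complex.I)) /
          ((((-(1 + ‖X.1 w‖ ^ 2 / 2)) : ℝ) : ℂ) + (((w.embedding δ).im * ((InfiniteAdeleRing.ringEquiv_mixedSpace ↥(maximalRealSubfield L)) t.1).1 ⟨w.comap (algebraMap ↥(maximalRealSubfield L) L), K2E1HeightBigCellLineFormulaU2.isReal_comap_maximalRealSubfield L w⟩ : ℝ) : ℂ) * Complex.I)) ^ p w *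
        (((2 : ℂ) + conj ((((-(1 + ‖X.1 w‖ ^ 2 / 2)) : ℝ) : ℂ) + (((w.embedding δ).im * ((InfiniteAdeleRing.ringEquiv_mixedSpace ↥(maximalRealSubfield L)) t.1).1 ⟨w.comap (algebraMap ↥(maximalRealSubfield L) L), K2E1HeightBigCellLineFormulaU2.isReal_comap_maximalRealSubfield L w⟩ : ℝ) : ℂ) * Complex.I)) /
          conj ((((-(1 + ‖X.1 w‖ ^ 2 / 2)) : ℝ) : ℂ) + (((w.embedding δ).im * ((InfiniteAdeleRing.ringEquiv_mixedSpace ↥(maximalRealSubfield L)) t.1).1 ⟨w.comap (algebraMap ↥(maximalRealSubfield L) L), K2E1HeightBigCellLineFormulaU2.isReal_comap_maximalRealSubfield L w⟩ : ℝ) : ℂ) * Complex.I)) ^ q w) *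
      ((adelicOneChar (↥(maximalRealSubfield L)) L (IsCMField.complexConj L) ξ.ψ
        (adelicDet (↥(maximalRealSubfield L)) L (IsCMField.complexConj L) 3 ((StdForm.antidiagonal 3).over L) (antidiagonal_over_det_ne_zero L 3)
          (archToAdelic (↥(maximalRealSubfield L)) L (IsCMField.complexConj L) 3 ((StdForm.antidiagonal 3).over L) (archPart (↥(maximalRealSubfield L)) L (IsCMField.complexConj L) 3 ((StdForm.antidiagonal 3).over L)
        ((quasiSplit (↥(maximalRealSubfield L)) L (IsCMField.complexConj L) 3).toAdelic (weylLongU ((IsCMField.complexConj L : L ≃ₐ[↥(maximalRealSubfield L)] L) : L →+* L) (rfl : (StdForm.antidiagonal 3).over L = (StdForm.antidiagonal 3).over L)) *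
          ((heisChart hc (X, traceZeroLine (↥(maximalRealSubfield L)) L (IsCMField.complexConj L) hcδ hδ t) : adelicUnipotent (↥(maximalRealSubfield L)) L (IsCMField.complexConj L) 3) :
            (quasiSplit (↥(maximalRealSubfield L)) L (IsCMField.complexConj L) 3).Adelic))))) : ℂˣ) : ℂ) := by
  rw [archSectionShifted_midBlock_bigCell_of_record L hcδ hδ hc ξ hμ p q X t, ← mul_assoc, ← Finset.prod_mul_distrib]
  congr 1
  refine Finset.prod_congr rfl fun w _ => ?_
  -- the `ζ`-letter at `w`
  have hζ := zeta_letter (embedding_re_eq_zero L hcδ w)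
    (((InfiniteAdeleRing.ringEquiv_mixedSpace ↥(maximalRealSubfield L) t.1).1 ⟨w.comap (algebraMap ↥(maximalRealSubfield L) L), K2E1HeightBigCellLineFormulaU2.isReal_comap_maximalRealSubfield L w⟩ : ℝ)) ‖X.1 w‖
  obtain ⟨hc1, hc2⟩ := conj_add_one_eq_two_add hζ
  rw [add_one_eq_two_add hζ, hζ, hc1, hc2, neg_one_zpow_mul_conj_archUnitaryValue, hζ]
  ring

include hc in
/-- **THE ARCH COLUMN OF `hsrc`, PHASE FOR PHASE**: GIVEN the torus value `ξ.ψ⟨det ι_∞ a⟩ = ∏_w ε_w` at the big-cell element of record (`ε := unfoldingArchPhase L ξ`; discharged below by `adelicOneChar_adelicDet_bigCell_eq_prod_unfoldingArchPhase`), ★ p13's shifted section at `a = (ι(w₀)·u(X, θ t))_∞` IS (V) OF RECORD's integrand: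
`Φ^{p,q}(a) = ∏_w ε_w · archUnitaryValue m_w 0 ζ_w · ((2 + ζ_w)∕ζ_w)^{p_w} · ((2 + conj ζ_w)∕conj ζ_w)^{q_w}`. [cite: MoeglinWaldspurger1995, IV.1.11] [cite: Rogawski1990, §13.9 p. 229] -/
theorem archSectionShifted_midBlock_bigCell_of_phase (ξ : OneDimAutRepH L) {μω : HeckeCharacter L} {kμ : InfinitePlace L → ℤ} (hμ : μω.HasUnitaryArchType kμ 0)
    (p q : InfinitePlace L → ℕ) (X : AdeleRing (𝓞 L) L) (t : AdeleRing (𝓞 ↥(maximalRealSubfield L)) ↥(maximalRealSubfield L))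
    (hdet : ((adelicOneChar (↥(maximalRealSubfield L)) L (IsCMField.complexConj L) ξ.ψ
        (adelicDet (↥(maximalRealSubfield L)) L (IsCMField.complexConj L) 3 ((StdForm.antidiagonal 3).over L) (antidiagonal_over_det_ne_zero L 3)
          (archToAdelic (↥(maximalRealSubfield L)) L (IsCMField.complexConj L) 3 ((StdForm.antidiagonal 3).over L) (archPart (↥(maximalRealSubfield L)) L (IsCMField.complexConj L) 3 ((StdForm.antidiagonal 3).over L)
        ((quasiSplit (↥(maximalRealSubfield L)) L (IsCMField.complexConj L) 3).toAdelic (weylLongU ((IsCMField.complexConj L : L ≃ₐ[↥(maximalRealSubfield L)] L) : L →+* L) (rfl : (StdForm.antidiagonal 3).over L = (StdForm.antidiagonal 3).over L)) *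
          ((heisChart hc (X, traceZeroLine (↥(maximalRealSubfield L)) L (IsCMField.complexConj L) hcδ hδ t) : adelicUnipotent (↥(maximalRealSubfield L)) L (IsCMField.complexConj L) 3) :
            (quasiSplit (↥(maximalRealSubfield L)) L (IsCMField.complexConj L) 3).Adelic))))) : ℂˣ) : ℂ) = ∏ w : InfinitePlace L, unfoldingArchPhase L ξ w) :
    archSectionShifted L (ξ.bcη⁻¹ * ξ.bcψ⁻¹ * μω) ξ.ψ p q (archPart (↥(maximalRealSubfield L)) L (IsCMField.complexConj L) 3 ((StdForm.antidiagonal 3).over L)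
        ((quasiSplit (↥(maximalRealSubfield L)) L (IsCMField.complexConj L) 3).toAdelic (weylLongU ((IsCMField.complexConj L : L ≃ₐ[↥(maximalRealSubfield L)] L) : L →+* L) (rfl : (StdForm.antidiagonal 3).over L = (StdForm.antidiagonal 3).over L)) *
          ((heisChart hc (X, traceZeroLine (↥(maximalRealSubfield L)) L (IsCMField.complexConj L) hcδ hδ t) : adelicUnipotent (↥(maximalRealSubfield L)) L (IsCMField.complexConj L) 3) :
            (quasiSplit (↥(maximalRealSubfield L)) L (IsCMField.complexConj L) 3).Adelic))) =
      ∏ w : InfinitePlace L, unfoldingArchPhase L ξ w * archUnitaryValue (kμ w - 2 * ξ.eη w) 0 ((((-(1 + ‖X.1 w‖ ^ 2 / 2)) : ℝ) : ℂ) + (((w.embedding δ).im * ((InfiniteAdeleRing.ringEquiv_mixedSpace ↥(maximalRealSubfield L)) t.1).1 ⟨w.comap (algebraMap ↥(maximalRealSubfield L) L), K2E1HeightBigCellLineFormulaU2.isReal_comap_maximalRealSubfield L w⟩ : ℝ) : ℂ) * Complex.I) *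
        (((2 : ℂ) + ((((-(1 + ‖X.1 w‖ ^ 2 / 2)) : ℝ) : ℂ) + (((w.embedding δ).im * ((InfiniteAdeleRing.ringEquiv_mixedSpace ↥(maximalRealSubfield L)) t.1).1 ⟨w.comap (algebraMap ↥(maximalRealSubfield L) L), K2E1HeightBigCellLineFormulaU2.isReal_comap_maximalRealSubfield L w⟩ : ℝ) : ℂ) * Complex.I)) /
          ((((-(1 + ‖X.1 w‖ ^ 2 / 2)) : ℝ) : ℂ) + (((w.embedding δ).im * ((InfiniteAdeleRing.ringEquiv_mixedSpace ↥(maximalRealSubfield L)) t.1).1 ⟨w.comap (algebraMap ↥(maximalRealSubfield L) L), K2E1HeightBigCellLineFormulaU2.isReal_comap_maximalRealSubfield L w⟩ : ℝ) : ℂ) * Complex.I)) ^ p w *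
        (((2 : ℂ) + conj ((((-(1 + ‖X.1 w‖ ^ 2 / 2)) : ℝ) : ℂ) + (((w.embedding δ).im * ((InfiniteAdeleRing.ringEquiv_mixedSpace ↥(maximalRealSubfield L)) t.1).1 ⟨w.comap (algebraMap ↥(maximalRealSubfield L) L), K2E1HeightBigCellLineFormulaU2.isReal_comap_maximalRealSubfield L w⟩ : ℝ) : ℂ) * Complex.I)) /
          conj ((((-(1 + ‖X.1 w‖ ^ 2 / 2)) : ℝ) : ℂ) + (((w.embedding δ).im * ((InfiniteAdeleRing.ringEquiv_mixedSpace ↥(maximalRealSubfield L)) t.1).1 ⟨w.comap (algebraMap ↥(maximalRealSubfield L) L), K2E1HeightBigCellLineFormulaU2.isReal_comap_maximalRealSubfield L w⟩ : ℝ) : ℂ) * Complex.I)) ^ q w := by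
  rw [archSectionShifted_midBlock_bigCell_zeta L hcδ hδ hc ξ hμ p q X t, hdet, mul_comm, ← Finset.prod_mul_distrib]
  refine Finset.prod_congr rfl fun w _ => ?_
  ring


include hc in
/-- **HEAD — THE ARCH COLUMN OF `hsrc`, UNCONDITIONAL**: at the archimedean big-cell element of record `a = (ι(w₀)·u(X, θ t))_∞`, for `μω` of unitary type `(kμ, 0)` and any shifts `p q`,
`Φ^{p,q}(a) = ∏_w unfoldingArchPhase ξ w · archUnitaryValue (kμ,w − 2eη,w) 0 ζ_w · ((2 + ζ_w)∕ζ_w)^{p_w} · ((2 + conj ζ_w)∕conj ζ_w)^{q_w}`, `ζ_w = −(1 + ‖X_w‖²∕2) + (Im φ_w(δ)·s_w(t))·I` —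
(V) OF RECORD's integrand at `ε := unfoldingArchPhase L ξ`, phase for phase (★ p864477 ∘ ★ (5a) cancellation ∘ the torus value §2). [cite: MoeglinWaldspurger1995, IV.1.11] [cite: Rogawski1990, §13.9 p. 229] -/
theorem archSectionShifted_midBlock_bigCell_eq_prod (ξ : OneDimAutRepH L) {μω : HeckeCharacter L} {kμ : InfinitePlace L → ℤ} (hμ : μω.HasUnitaryArchType kμ 0)
    (p q : InfinitePlace L → ℕ) (X : AdeleRing (𝓞 L) L) (t : AdeleRing (𝓞 ↥(maximalRealSubfield L)) ↥(maximalRealSubfield L)) :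
    archSectionShifted L (ξ.bcη⁻¹ * ξ.bcψ⁻¹ * μω) ξ.ψ p q (archPart (↥(maximalRealSubfield L)) L (IsCMField.complexConj L) 3 ((StdForm.antidiagonal 3).over L)
        ((quasiSplit (↥(maximalRealSubfield L)) L (IsCMField.complexConj L) 3).toAdelic (weylLongU ((IsCMField.complexConj L : L ≃ₐ[↥(maximalRealSubfield L)] L) : L →+* L) (rfl : (StdForm.antidiagonal 3).over L = (StdForm.antidiagonal 3).over L)) *
          ((heisChart hc (X, traceZeroLine (↥(maximalRealSubfield L)) L (IsCMField.complexConj L) hcδ hδ t) : adelicUnipotent (↥(maximalRealSubfield L)) L (IsCMField.complexConj L) 3) :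
            (quasiSplit (↥(maximalRealSubfield L)) L (IsCMField.complexConj L) 3).Adelic))) =
      ∏ w : InfinitePlace L, unfoldingArchPhase L ξ w * archUnitaryValue (kμ w - 2 * ξ.eη w) 0 ((((-(1 + ‖X.1 w‖ ^ 2 / 2)) : ℝ) : ℂ) + (((w.embedding δ).im * ((InfiniteAdeleRing.ringEquiv_mixedSpace ↥(maximalRealSubfield L)) t.1).1 ⟨w.comap (algebraMap ↥(maximalRealSubfield L) L), K2E1HeightBigCellLineFormulaU2.isReal_comap_maximalRealSubfield L w⟩ : ℝ) : ℂ) * Complex.I) *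
        (((2 : ℂ) + ((((-(1 + ‖X.1 w‖ ^ 2 / 2)) : ℝ) : ℂ) + (((w.embedding δ).im * ((InfiniteAdeleRing.ringEquiv_mixedSpace ↥(maximalRealSubfield L)) t.1).1 ⟨w.comap (algebraMap ↥(maximalRealSubfield L) L), K2E1HeightBigCellLineFormulaU2.isReal_comap_maximalRealSubfield L w⟩ : ℝ) : ℂ) * Complex.I)) / ((((-(1 + ‖X.1 w‖ ^ 2 / 2)) : ℝ) : ℂ) + (((w.embedding δ).im * ((InfiniteAdeleRing.ringEquiv_mixedSpace ↥(maximalRealSubfield L)) t.1).1 ⟨w.comap (algebraMap ↥(maximalRealSubfield L) L), K2E1HeightBigCellLineFormulaU2.isReal_comap_maximalRealSubfield L w⟩ : ℝ) : ℂ) * Complex.I)) ^ p w * (((2 : ℂ) + conj ((((-(1 + ‖X.1 w‖ ^ 2 / 2)) : ℝ) : ℂ) + (((w.embedding δ).im * ((InfiniteAdeleRing.ringEquiv_mixedSpace ↥(maximalRealSubfield L)) t.1).1 ⟨w.comap (algebraMap ↥(maximalRealSubfield L) L), K2E1HeightBigCellLineFormulaU2.isReal_comap_maximalRealSubfield L w⟩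 : ℝ) : ℂ) * Complex.I)) / conj ((((-(1 + ‖X.1 w‖ ^ 2 / 2)) : ℝ) : ℂ) + (((w.embedding δ).im * ((InfiniteAdeleRing.ringEquiv_mixedSpace ↥(maximalRealSubfield L)) t.1).1 ⟨w.comap (algebraMap ↥(maximalRealSubfield L) L), K2E1HeightBigCellLineFormulaU2.isReal_comap_maximalRealSubfield L w⟩ : ℝ) : ℂ) * Complex.I)) ^ q w :=
  archSectionShifted_midBlock_bigCell_of_phase L hcδ hδ hc ξ hμ p q X t
    (adelicOneChar_adelicDet_bigCell_eq_prod_unfoldingArchPhase L ξ (heisChart hc (X, traceZeroLine (↥(maximalRealSubfield L)) L (IsCMField.complexConj L) hcδ hδ t)))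

end BigCell


end Summit.HodgeConjecture.HodgeConjecture.Cruxes.H413.K2E1ChiUnfoldingArchPhaseOfRecordU3

end
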